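import Summits.Ventures.HodgeRepro2.T5SU11Cartan

/-!
# Uniqueness of the Cartan coordinates of `SU(1,1)`

`T5SU11Cartan.exists_cartan` writes every `g ∈ SU(1,1)` as `rot u · a_t · rot v` with `t ≥ 0`.  Here the
coordinates are shown to be determined by `g`:

* `cosh t = |a|`, `sinh t = |b|` for `g = su11 a b` (`cosh_eq_norm`, `sinh_eq_norm`), hence `t` is unique
  (`t_unique`) and equal to `arsinh |b|` (`t_eq_arsinh`) — Rühl's `η = 2t`, `cosh(η/2) = |a|`;
* for `t > 0` the pair `(u, v)` is unique up to the simultaneous sign `(u, v) ↦ (-u, -v)`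
  (`angles_unique`), and `u v` is always unique (`mul_unique`) — the ambiguity of the angles
  `(ψ₁, ψ₂)` of the `K A⁺ K` coordinates `g = k(ψ₁) a(η) k(ψ₂)` is exactly `{±1}`, the centre of `SU(1,1)`
  (`rot (-u) · a_t · rot (-v) = rot u · a_t · rot v`, `rot_neg_mul_hyp_mul_rot_neg`).

This is the «uniqueness of the Cartan coordinates» item left open in the record of the Cartan row
(`T5SU11Cartan`), and the justification of the KAK integration formula's coordinates
(`T5SU11FibrationCartan.integral_eq_cartan`) as coordinates.

Blind lane: Mathlib + the HodgeRepro2 prefix only; no sorry; axioms ⊆ {propext, Classical.choice,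
Quot.sound}.
-/

namespace Summit.Ventures.HodgeRepro2.T5SU11CartanUnique

open T5PoincareDensity T5SU11Unimodular T5SU11Fibration T5BergmanCoefficient T5SU11Cartan

/-! ### The entries of `rot u · a_t · rot v` -/

/-- The `(0,0)` entry: `u v cosh t`. -/
lemma mat_apply_zero_zero (u v : Circle) (t : ℝ) :
    mat (rot u * hyp t * rot v) 0 0 = (u : ℂ) * v * Real.cosh t := by
  rw [mat_rot_mul_hyp_mul_rot]
  simp [su11]

/-- The `(0,1)` entry: `u v̄ sinh t`. -/
lemma mat_apply_zero_one (u v : Circle) (t : ℝ) :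
    mat (rot u * hyp t * rot v) 0 1 = (u : ℂ) * (starRingEnd ℂ) (v : ℂ) * Real.sinh t := by
  rw [mat_rot_mul_hyp_mul_rot]
  simp [su11]

/-- `|a| = cosh t` for `g = rot u · a_t · rot v = su11 a b` (any `t`). -/
theorem cosh_eq_norm (u v : Circle) (t : ℝ) :
    Real.cosh t = ‖mat (rot u * hyp t * rot v) 0 0‖ := by
  rw [mat_apply_zero_zero, norm_mul, norm_mul, Circle.norm_coe, Circle.norm_coe, Complex.norm_real,
    Real.norm_eq_abs, abs_of_pos (Real.cosh_pos t)]
  ring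

/-- `|b| = sinh t` for `g = rot u · a_t · rot v = su11 a b` and `t ≥ 0`. -/
theorem sinh_eq_norm (u v : Circle) {t : ℝ} (ht : 0 ≤ t) :
    Real.sinh t = ‖mat (rot u * hyp t * rot v) 0 1‖ := by
  rw [mat_apply_zero_one, norm_mul, norm_mul, Circle.norm_coe, Complex.norm_conj, Circle.norm_coe,
    Complex.norm_real, Real.norm_eq_abs, abs_of_nonneg (Real.sinh_nonneg_iff.mpr ht)]
  ring

/-! ### Uniqueness of the hyperbolic parameter -/

/-- **`t` is unique**: `rot u · a_t · rot v = rot u' · a_{t'} · rot v'` with `t, t' ≥ 0` forces `t = t'`. -/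
theorem t_unique {u v u' v' : Circle} {t t' : ℝ} (ht : 0 ≤ t) (ht' : 0 ≤ t')
    (hg : rot u * hyp t * rot v = rot u' * hyp t' * rot v') : t = t' := by
  have h1 := sinh_eq_norm u v ht
  have h2 := sinh_eq_norm u' v' ht'
  rw [hg] at h1
  exact Real.sinh_injective (h1.trans h2.symm)

/-- **`t` is `arsinh |b|`**: the hyperbolic parameter of `g = su11 a b` is read off from `g`. -/
theorem t_eq_arsinh (u v : Circle) {t : ℝ} (ht : 0 ≤ t) :
    t = Real.arsinh ‖mat (rot u * hyp t * rot v) 0 1‖ := by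
  rw [← sinh_eq_norm u v ht, Real.arsinh_sinh]

/-- `t` is also `arcosh |a|` in the form `cosh t = |a|`: `t = arsinh (√(|a|² - 1))`. -/
theorem t_eq_arsinh_sqrt (u v : Circle) {t : ℝ} (ht : 0 ≤ t) :
    t = Real.arsinh (Real.sqrt (‖mat (rot u * hyp t * rot v) 0 0‖ ^ 2 - 1)) := by
  rw [← cosh_eq_norm, Real.cosh_sq, add_sub_cancel_right, Real.sqrt_sq (Real.sinh_nonneg_iff.mpr ht),
    Real.arsinh_sinh]

/-! ### Uniqueness of the angles -/

/-- **`u v` is unique** (for every `t`): the product of the angles is determined by the `(0,0)` entry. -/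
theorem mul_unique {u v u' v' : Circle} {t : ℝ}
    (hg : rot u * hyp t * rot v = rot u' * hyp t * rot v') : u * v = u' * v' := by
  have h := congrArg (fun g => mat g 0 0) hg
  simp only [mat_apply_zero_zero] at h
  have hc : (Real.cosh t : ℂ) ≠ 0 := by exact_mod_cast (Real.cosh_pos t).ne'
  apply Circle.ext
  rw [Circle.coe_mul, Circle.coe_mul]
  exact mul_right_cancel₀ hc h

/-- `u v̄` is unique for `t ≠ 0`. -/
theorem mul_conj_unique {u v u' v' : Circle} {t : ℝ} (ht : t ≠ 0)
    (hg : rot u * hyp t * rot v = rot u' * hyp t * rot v') :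
    (u : ℂ) * (starRingEnd ℂ) (v : ℂ) = (u' : ℂ) * (starRingEnd ℂ) (v' : ℂ) := by
  have h := congrArg (fun g => mat g 0 1) hg
  simp only [mat_apply_zero_one] at h
  have hs : (Real.sinh t : ℂ) ≠ 0 := by
    have : Real.sinh t ≠ 0 := fun h0 => ht (Real.sinh_injective (h0.trans Real.sinh_zero.symm))
    exact_mod_cast this
  exact mul_right_cancel₀ hs h

/-- **The angles are unique up to the common sign** for `t ≠ 0`:
`rot u · a_t · rot v = rot u' · a_t · rot v'` forces `(u, v) = (u', v')` or `(u, v) = (-u', -v')`. -/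
theorem angles_unique {u v u' v' : Circle} {t : ℝ} (ht : t ≠ 0)
    (hg : rot u * hyp t * rot v = rot u' * hyp t * rot v') :
    (u = u' ∧ v = v') ∨ (u = -u' ∧ v = -v') := by
  have h1 : (u : ℂ) * v = (u' : ℂ) * v' := by
    have := congrArg (fun x : Circle => (x : ℂ)) (mul_unique hg)
    simpa using this
  have h2 := mul_conj_unique ht hg
  have hv : (v : ℂ) * (starRingEnd ℂ) (v : ℂ) = 1 := by
    rw [Complex.mul_conj, Complex.normSq_eq_norm_sq, Circle.norm_coe]; simp
  have hv' : (v' : ℂ) * (starRingEnd ℂ) (v' : ℂ) = 1 := by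
    rw [Complex.mul_conj, Complex.normSq_eq_norm_sq, Circle.norm_coe]; simp
  -- `u² = (uv)(u v̄) = (u'v')(u' v̄') = u'²`
  have hsq : (u : ℂ) ^ 2 = (u' : ℂ) ^ 2 := by
    have e1 : (u : ℂ) ^ 2 = ((u : ℂ) * v) * ((u : ℂ) * (starRingEnd ℂ) (v : ℂ)) := by
      linear_combination (-(u : ℂ) ^ 2) * hv
    have e2 : (u' : ℂ) ^ 2 = ((u' : ℂ) * v') * ((u' : ℂ) * (starRingEnd ℂ) (v' : ℂ)) := by
      linear_combination (-(u' : ℂ) ^ 2) * hv'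
    rw [e1, e2, h1, h2]
  have hu' : (u' : ℂ) ≠ 0 := Circle.coe_ne_zero u'
  rcases sq_eq_sq_iff_eq_or_eq_neg.mp hsq with h | h
  · left
    refine ⟨Circle.ext h, Circle.ext ?_⟩
    rw [h] at h1
    exact mul_left_cancel₀ hu' h1
  · right
    refine ⟨Circle.ext (by rw [h, Circle.coe_neg]), Circle.ext ?_⟩
    rw [Circle.coe_neg]
    rw [h] at h1
    have h3 : (u' : ℂ) * (-(v : ℂ)) = (u' : ℂ) * v' := by linear_combination h1
    have h4 := mul_left_cancel₀ hu' h3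
    linear_combination -h4

/-- The common sign is invisible: `rot (-u) · a_t · rot (-v) = rot u · a_t · rot v` (the centre `{±1}`). -/
theorem rot_neg_mul_hyp_mul_rot_neg (u v : Circle) (t : ℝ) :
    rot (-u) * hyp t * rot (-v) = rot u * hyp t * rot v := by
  apply Subtype.ext
  apply Subtype.ext
  show mat (rot (-u) * hyp t * rot (-v)) = mat (rot u * hyp t * rot v)
  rw [mat_rot_mul_hyp_mul_rot, mat_rot_mul_hyp_mul_rot]
  simp only [Circle.coe_neg, map_neg]
  congr 1 <;> ring

end Summit.Ventures.HodgeRepro2.T5SU11CartanUnique
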